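import Literature.NumberTheory.EllipticCurves.Kato2004.IwasawaH1LayerEigenfunctionalZetaTwoProofs
import Literature.NumberTheory.EllipticCurves.Kato2004.ZetaBodyLayerValuesTwoMemberProofs
import Summits.BirchSwinnertonDyer.BirchSwinnertonDyer.Theorems.CyclotomicUntwistRohrlichAtLevel
import HarnessLib

/-!
# Route ByReductionTypeAtTwo, crux `AdditiveRankZeroAtTwo` (stmt-BirchSwinnertonDyer-19098), child C4″
# (stmt-BirchSwinnertonDyer-22618) — reading step T22 (b) of the descent sockets, KATO SIDE: the pinned Λ-adic zeta class
# `y ∈ 𝐇¹_Γ(T₂W)` is a non-zero genuine `2`-adic Euler-system class AND carries, for every primitive even character `χ` of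
# `2`-power conductor off a FINITE set, a finite-level `χ(γ₀)`-eigenfunctional `w` with `w(proj_n y) ≠ 0` — a THEOREM
# modulo ONLY Kato's construction fact (Rohrlich at `2 ∣ N` fed from the kernel)

Cell `bsd-2adic` (run/shared/lean/pub/bsd-2adic/), seat `bsd-2adic-addL2x` GEN 20 (repair-census entry R-B83 (2)+(3)). The
descent sockets' step T22 (b) («Z̃ and Z(f_W) agree at every height-one 𝔮 ∌ 2») is the kernel theorem
`AddKatoTwo.lengthAt_quotient_zetaLine_eq_of_characterValues` / `Kato2004.IwasawaH1Data.lengthAt_quotient_span_eq_of_layerFunctionals`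
(GEN 19, p741272 / p741570) whose hypothesis `hw` asks, for every primitive even `χ` off a finite `S`, for a layer `n` and a
`ℤ₂`-semilinear `χ(γ₀)`-eigenfunctional `w` on `H¹(ℚ_n, T₂W)` with (Kato side) `w(proj_n z) ≠ 0` and (odd-branch side)
`α·w(proj_n z̃) = β·w(proj_n z)`. THIS FILE discharges the KATO SIDE for the class this route means by `Z(f_W)` — the Λ-adic
lift `y` of Kato's zeta family — from the tree's Literature theorems of this GEN:
`Kato2004.exists_finset_forall_layerEigenfunctional_lift_ne_zero_two` (p745359: the eigenfunctionals are the `χ`-weighted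
dual-exponential sums of Thm. 12.5 (1) at the LEVEL `ℚ(μ_{2^{n+2}})` restricted to the LAYER `ℚ_n`, non-zero by the value law
(C5), Kato's guarded datum and Rohrlich), `Kato2004.exists_isEulerSystemClassTwo_of_zetaBody`,
`Kato2004.zetaBody_lift_ne_zero_of_rohrlich_two`, `Kato2004.exists_katoDatum`, with Rohrlich's finiteness the KERNEL theorem
`PSRohrlichAtLevel.rohrlich_primePow_of_isNewformOf` (any prime; `2 ∣ N` allowed):

* `AddKatoTwo.exists_esClassTwo_ne_zero_layerEigenfunctionals` — `W[2]` irreducible, GRANTED `Kato2004.exists_eulerSystem_expStar_values`;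
* `AddKatoTwo.exists_esClassTwo_ne_zero_layerEigenfunctionals_of_member` — EVERY elliptic `W/ℚ`, GRANTED the member fact
  `Kato2004.exists_member_eulerSystem_expStar_values`.

WHAT REMAINS A READING in T22 (b) after this file (named precisely): the ODD-BRANCH side — the values of the transported class
`z̃` under the SAME functionals and the single period ratio `α/β` (the odd-branch package p724228 does not pin `Z̃` to a
`ZetaBody` of `f′`; GEN 18 §4 (2) / R-B83 (1)). HONEST FRAMING (D-0036/D-0054): theorems only, conditional on the named
construction fact (hypothesis BY NAME, never asserted); closes nothing; nothing booked; the sockets stay `@[conjecture]`; BSD is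
not proved by any of this.

References: [Kato2004Asterisque] Thm. 12.5 (1) (pp. 221–222), Thm. 9.7 (p. 189), Thm. 6.6 (1) (p. 163), §13.8 (p. 228), 13.5 (2)
(p. 227), Thm. 13.4 (i) (p. 226); [RohrlichInventiones1984]; [MazurTateTeitelbaum1986Invent] §I.13; [Washington1997] §13.1.
-/

set_option autoImplicit false
-- the summit's namespace `Summit.BirchSwinnertonDyer.BirchSwinnertonDyer` (Sub = Summit) trips `dupNamespace`
set_option linter.dupNamespace false

noncomputable section

namespace Summit.BirchSwinnertonDyer.BirchSwinnertonDyer.Theorems.AddKatoTwo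

open Field CongruenceSubgroup WeierstrassCurve Literature.NumberTheory.GaloisRepresentations
  Literature.NumberTheory.EllipticCurves Literature.NumberTheory.EllipticCurves.ModularForms
  Literature.NumberTheory.EllipticCurves.Kato2004 Literature.NumberTheory.EllipticCurves.Kato2004.EulerSystemValues

variable (W : WeierstrassCurve ℚ) [W.IsElliptic] [ContinuousSMul ℤ_[2] (W.tateModule 2)]
  [Module.Free ℤ_[2] (W.tateModule 2)] [Module.Finite ℤ_[2] (W.tateModule 2)] {κ : ZpExtension ℚ 2}
  {γ : absoluteGaloisGroup ℚ} (I : Kato2004.IwasawaH1Data W 2 κ γ)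

/-- **T22 (b), Kato side, at `p = 2`, modulo ONLY the construction fact (`W[2]` irreducible).** For `W/ℚ` elliptic with
`W[2]` irreducible, `f` a newform of `W`, `κ` the cyclotomic `ℤ₂`-extension with topological generator `γ` and any pin `I`:
GRANTED `Kato2004.exists_eulerSystem_expStar_values`, there is `y ∈ 𝐇¹_Γ(T₂W)` — a genuine `2`-adic Euler-system class
(`Kato2004.IsEulerSystemClassTwo`), non-zero — and a finite `S ⊂ ℂ₂` such that every primitive EVEN `ℂ₂`-valued Dirichlet
character `χ` mod `2^m` with `χ(γ₀) − 1 ∉ S` (`γ₀ = cyclotomicGenerator 2 = 5`) has a layer `n` and an additive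
`w : H¹(ℚ_n, T₂W) → ℂ₂`, `ℤ₂`-semilinear, a `χ(γ₀)`-eigenfunctional for `conj_γ`, with `χ(γ₀)^{2^n} = 1` and
`w(proj_n y) ≠ 0`. Rohrlich is the kernel theorem `PSRohrlichAtLevel.rohrlich_primePow_of_isNewformOf`.
[cite: Kato2004Asterisque, Thm. 12.5 (1) (pp. 221–222), 13.5 (2) (p. 227), Thm. 13.4 (i) (p. 226)] [cite: RohrlichInventiones1984, Theorem (p. 409)] -/
theorem exists_esClassTwo_ne_zero_layerEigenfunctionals (hκ : κ.IsCyclotomic) (hγ : κ.IsTopGenerator γ)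
    (hES : Kato2004.exists_eulerSystem_expStar_values) (hirr : W.HasIrreducibleModPGaloisRep 2) {N : ℕ} [NeZero N]
    (f : CuspForm (Gamma0 N) 2) (hf : IsNewformOf W f) :
    ∃ y : I.H, Kato2004.IsEulerSystemClassTwo W hκ I y ∧ y ≠ 0 ∧
      ∃ S : Finset ℂ_[2], ∀ m : ℕ, 0 < m → ∀ χ : DirichletCharacter ℂ_[2] (2 ^ m), χ.IsPrimitive → χ.Even →
        (χ (cyclotomicGenerator 2 : ZMod (2 ^ m)) - 1) ∉ S →
        ∃ (n : ℕ) (w : H1 (tateRep W 2) (κ.layerSubgroup n) →+ ℂ_[2]),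
          χ (cyclotomicGenerator 2 : ZMod (2 ^ m)) ^ 2 ^ n = 1 ∧
          (∀ (e : ℤ_[2]) (v : H1 (tateRep W 2) (κ.layerSubgroup n)),
            w (e • v) = ((algebraMap ℚ_[2] ℂ_[2]).comp (algebraMap ℤ_[2] ℚ_[2])) e * w v) ∧
          (∀ v : H1 (tateRep W 2) (κ.layerSubgroup n),
            w ((conjMap (tateRep W 2).toTopRep (κ.layerSubgroup n) γ 1).hom.toLinearMap v) =
              χ (cyclotomicGenerator 2 : ZMod (2 ^ m)) * w v) ∧
          w (I.proj n y) ≠ 0 := by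
  set ι : (m : ℕ) → (CyclotomicField m ℚ →+* ℂ) :=
    fun m ↦ Classical.choice (inferInstance : Nonempty (CyclotomicField m ℚ →+* ℂ)) with hι
  obtain ⟨κ', hκ'0, Λ', hfam⟩ := hES W 2 hirr f hf ι
  obtain ⟨c, d, a, A, hA, hc, hd, hcA, hdA, hc1, hd1, ha⟩ :=
    Kato2004.exists_katoDatum f hf.1 hf.coeffField_eq_bot 2
  obtain ⟨z, x, hbody⟩ := hfam c d a A hA hc hd
  have hne := Kato2004.two_mul_natAbs_ne_zero_of_guards 2 hA (NeZero.ne N) hc hd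
  obtain ⟨y, hyES, hy⟩ := Kato2004.exists_isEulerSystemClassTwo_of_zetaBody W hκ I f ι κ' Λ' c d a A z x hbody hne
  have hR := PSRohrlichAtLevel.rohrlich_primePow_of_isNewformOf (p := 2) hf
  refine ⟨y, hyES, Kato2004.zetaBody_lift_ne_zero_of_rohrlich_two hbody hf hκ'0 hA hc hd hcA hdA hc1 hd1 ha hκ hy hR, ?_⟩
  exact Kato2004.exists_finset_forall_layerEigenfunctional_lift_ne_zero_two hbody hf hκ'0 hA hc hd hcA hdA hc1 hd1 ha
    hκ hγ hy hR

/-- **T22 (b), Kato side, at `p = 2`, for EVERY elliptic curve, modulo ONLY the MEMBER construction fact.** Same conclusion as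
`exists_esClassTwo_ne_zero_layerEigenfunctionals` for every elliptic `W/ℚ` (reducible `E[2]` included — the 41 + 9
split-twist rows of C4″), GRANTED `Kato2004.exists_member_eulerSystem_expStar_values` (Kato (8.1.3)/Ex. 13.3 realised on an
isogenous member and transported, `Kato2004.forall_exists_zetaBody_of_member`).
[cite: Kato2004Asterisque, Thm. 12.5 (1) (pp. 221–222), Ex. 13.3 (p. 225), §8.3 (p. 181)] [cite: RohrlichInventiones1984, Theorem (p. 409)] -/
theorem exists_esClassTwo_ne_zero_layerEigenfunctionals_of_member (hκ : κ.IsCyclotomic) (hγ : κ.IsTopGenerator γ)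
    (hES : Kato2004.exists_member_eulerSystem_expStar_values) {N : ℕ} [NeZero N] (f : CuspForm (Gamma0 N) 2)
    (hf : IsNewformOf W f) :
    ∃ y : I.H, Kato2004.IsEulerSystemClassTwo W hκ I y ∧ y ≠ 0 ∧
      ∃ S : Finset ℂ_[2], ∀ m : ℕ, 0 < m → ∀ χ : DirichletCharacter ℂ_[2] (2 ^ m), χ.IsPrimitive → χ.Even →
        (χ (cyclotomicGenerator 2 : ZMod (2 ^ m)) - 1) ∉ S →
        ∃ (n : ℕ) (w : H1 (tateRep W 2) (κ.layerSubgroup n) →+ ℂ_[2]),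
          χ (cyclotomicGenerator 2 : ZMod (2 ^ m)) ^ 2 ^ n = 1 ∧
          (∀ (e : ℤ_[2]) (v : H1 (tateRep W 2) (κ.layerSubgroup n)),
            w (e • v) = ((algebraMap ℚ_[2] ℂ_[2]).comp (algebraMap ℤ_[2] ℚ_[2])) e * w v) ∧
          (∀ v : H1 (tateRep W 2) (κ.layerSubgroup n),
            w ((conjMap (tateRep W 2).toTopRep (κ.layerSubgroup n) γ 1).hom.toLinearMap v) =
              χ (cyclotomicGenerator 2 : ZMod (2 ^ m)) * w v) ∧
          w (I.proj n y) ≠ 0 := by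
  set ι : (m : ℕ) → (CyclotomicField m ℚ →+* ℂ) :=
    fun m ↦ Classical.choice (inferInstance : Nonempty (CyclotomicField m ℚ →+* ℂ)) with hι
  obtain ⟨κ', hκ'0, Λ', hfam⟩ := Kato2004.forall_exists_zetaBody_of_member hES W 2 f hf ι
  obtain ⟨c, d, a, A, hA, hc, hd, hcA, hdA, hc1, hd1, ha⟩ :=
    Kato2004.exists_katoDatum f hf.1 hf.coeffField_eq_bot 2
  obtain ⟨z, x, hbody⟩ := hfam c d a A hA hc hd
  have hne := Kato2004.two_mul_natAbs_ne_zero_of_guards 2 hA (NeZero.ne N) hc hd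
  obtain ⟨y, hyES, hy⟩ := Kato2004.exists_isEulerSystemClassTwo_of_zetaBody W hκ I f ι κ' Λ' c d a A z x hbody hne
  have hR := PSRohrlichAtLevel.rohrlich_primePow_of_isNewformOf (p := 2) hf
  refine ⟨y, hyES, Kato2004.zetaBody_lift_ne_zero_of_rohrlich_two hbody hf hκ'0 hA hc hd hcA hdA hc1 hd1 ha hκ hy hR, ?_⟩
  exact Kato2004.exists_finset_forall_layerEigenfunctional_lift_ne_zero_two hbody hf hκ'0 hA hc hd hcA hdA hc1 hd1 ha
    hκ hγ hy hR

end Summit.BirchSwinnertonDyer.BirchSwinnertonDyer.Theorems.AddKatoTwo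

end
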